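import Mathlib.GroupTheory.Index
import Mathlib.GroupTheory.QuotientGroup.Basic
import Mathlib.Algebra.BigOperators.Group.Finset.Basic
import Mathlib.Tactic
import HarnessLib

/-!
# GASCHÜTZ AVERAGING for central `2`-cocycles: a coboundary on a subgroup of finite index `n`, `n` invertible, is a coboundary
# (route `ManinLocalTwoThree`, cell bsd-f2-manin; seat `bsd-line-manin23-p2` gen 12; input of the Heisenberg lift mod `p ≥ 5`)

Pure group theory, explicit (no cohomology library, no definitions).  Let `G` be a group, `H ≤ G` a subgroup of finite index
`n`, `Z` a commutative ring in which `n` is invertible, and `c : G → G → Z` a (central, inhomogeneous) 2-COCYCLE: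
`c x y + c (x y) z = c y z + c x (y z)` (e.g. `c x y = β x · λ y` for additive `β, λ`: `twoCocycle_mul`).  If `c` is a
COBOUNDARY ON `H` — some `μ₀` with `μ₀ (h k) = μ₀ h + μ₀ k + c h k` for `h, k ∈ H` — then `c` is a coboundary on `G`:
there is `μ : G → Z` with `μ (x y) = μ x + μ y + c x y` (`exists_coboundary_of_coboundary_on_finiteIndex`).  This is
Gaschütz's complement theorem / `cor ∘ res = n` in degree 2 with trivial coefficients, written out: an `H`-equivariant
section `μ₁` along a left transversal (`g = rep g · η g`), the defect `f := c − δμ₁` is invariant under `y ↦ y k` (`k ∈ H`),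
its coset average `φ`, and `n • f = φ x + φ y − φ (x y)` by summing the cocycle identity over `G/H`; then
`μ := μ₁ − n⁻¹ φ`.  Consumer: the Heisenberg lift mod `p ≥ 5` at every level (from the free subgroup of index `∣ 12` of
`Γ₀(M)`), input of the prime-generic shift-equaliser programme.  Nothing about BSD or Manin's conjecture is proved here.
-/

set_option linter.dupNamespace false

open scoped BigOperators

namespace Summit.BirchSwinnertonDyer.BirchSwinnertonDyer.Theorems.ManinLocalTwoThree

namespace Gaschuetz

variable {G : Type*} [Group G] {Z : Type*} [CommRing Z]

/-- The product `β ⊗ λ` of two additive maps is a (central, inhomogeneous) `2`-cocycle: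
`c x y + c (x y) z = c y z + c x (y z)`. [folklore] -/
theorem twoCocycle_mul {β lam : G → Z} (hβ : ∀ x y, β (x * y) = β x + β y) (hlam : ∀ x y, lam (x * y) = lam x + lam y) :
    ∀ x y z : G, β x * lam y + β (x * y) * lam z = β y * lam z + β x * lam (y * z) := by
  intro x y z
  simp only [hβ, hlam]
  ring

/-- A coboundary is a `2`-cocycle. [folklore] -/
theorem twoCocycle_of_coboundary {c : G → G → Z} {μ : G → Z} (h : ∀ x y, μ (x * y) = μ x + μ y + c x y) :
    ∀ x y z : G, c x y + c (x * y) z = c y z + c x (y * z) := by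
  intro x y z
  have h1 := h (x * y) z
  have h2 := h x (y * z)
  have h3 := h x y
  have h4 := h y z
  rw [mul_assoc] at h1
  linear_combination -h3 - h1 + h4 + h2

/-- **Gaschütz averaging (degree `2`, trivial coefficients), explicit**, with a `Fintype (G ⧸ H)` instance: if `|G/H|`
is invertible in `Z` and the `2`-cocycle `c` is a coboundary on `H`, then `c` is a coboundary on `G`. [folklore] -/
theorem exists_coboundary (H : Subgroup G) [Fintype (G ⧸ H)] (hn : IsUnit (Fintype.card (G ⧸ H) : Z))
    (c : G → G → Z) (hc : ∀ x y z : G, c x y + c (x * y) z = c y z + c x (y * z))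
    (μ₀ : G → Z) (hμ₀ : ∀ h ∈ H, ∀ k ∈ H, μ₀ (h * k) = μ₀ h + μ₀ k + c h k) :
    ∃ μ : G → Z, ∀ x y : G, μ (x * y) = μ x + μ y + c x y := by
  -- the left transversal `rep`, the `H`-part `η`
  set rep : G → G := fun g => Quotient.out (QuotientGroup.mk (s := H) g) with hrep
  have rep_mem : ∀ g : G, g⁻¹ * rep g ∈ H := fun g => by
    rw [hrep, ← QuotientGroup.eq, QuotientGroup.out_eq']
  have rep_mul : ∀ (g : G) {k : G}, k ∈ H → rep (g * k) = rep g := fun g k hk => by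
    simp only [hrep]
    congr 1
    rw [QuotientGroup.eq]
    simpa [mul_assoc] using H.inv_mem hk
  set eta : G → G := fun g => (rep g)⁻¹ * g with heta
  have eta_mem : ∀ g : G, eta g ∈ H := fun g => by
    have h := H.inv_mem (rep_mem g)
    simpa [heta, mul_inv_rev] using h
  have rep_mul_eta : ∀ g : G, rep g * eta g = g := fun g => by simp [heta]
  have eta_mul : ∀ (g : G) {k : G}, k ∈ H → eta (g * k) = eta g * k := fun g k hk => by
    simp [heta, rep_mul g hk, mul_assoc]
  -- the `H`-equivariant section and the defect
  set sec : G → Z := fun g => μ₀ (eta g) + c (rep g) (eta g) with hsec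
  set f : G → G → Z := fun x y => sec x + sec y + c x y - sec (x * y) with hf
  have f_mul : ∀ (x y : G) {k : G}, k ∈ H → f x (y * k) = f x y := by
    intro x y k hk
    simp only [hf, hsec]
    rw [show x * (y * k) = x * y * k by rw [mul_assoc], eta_mul y hk, eta_mul (x * y) hk, rep_mul y hk,
      rep_mul (x * y) hk, hμ₀ _ (eta_mem y) _ hk, hμ₀ _ (eta_mem (x * y)) _ hk]
    have e1 := hc (rep y) (eta y) k
    have e2 := hc (rep (x * y)) (eta (x * y)) k
    have e3 := hc x y k
    rw [rep_mul_eta] at e1 e2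
    linear_combination -e1 + e2 - e3
  have f_cocycle : ∀ x y z : G, f x y + f (x * y) z = f y z + f x (y * z) := by
    intro x y z
    simp only [hf]
    have := hc x y z
    rw [← mul_assoc]
    linear_combination this
  -- the coset average
  set φ : G → Z := fun x => ∑ q : G ⧸ H, f x (Quotient.out q) with hφ
  have sum_f_mul : ∀ x y : G, ∑ q : G ⧸ H, f x (y * Quotient.out q) = φ x := by
    intro x y
    have hterm : ∀ q : G ⧸ H, f x (y * Quotient.out q) = f x (Quotient.out (y • q)) := by
      intro q
      have hq : (QuotientGroup.mk (y * Quotient.out q) : G ⧸ H) = y • q := MulAction.Quotient.coe_smul_out H y q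
      have hmem : (Quotient.out (y • q))⁻¹ * (y * Quotient.out q) ∈ H := by
        rw [← QuotientGroup.eq, QuotientGroup.out_eq', hq]
      obtain ⟨k, hk, hyk⟩ : ∃ k ∈ H, y * Quotient.out q = Quotient.out (y • q) * k :=
        ⟨_, hmem, by rw [mul_inv_cancel_left]⟩
      rw [hyk, f_mul _ _ hk]
    simp_rw [hterm]
    exact Fintype.sum_equiv (MulAction.toPerm y) _ _ (fun q => rfl)
  have card_mul_f : ∀ x y : G, (Fintype.card (G ⧸ H) : Z) * f x y = φ x + φ y - φ (x * y) := by
    intro x y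
    have hsum : ∑ q : G ⧸ H, (f x y + f (x * y) (Quotient.out q)) =
        ∑ q : G ⧸ H, (f y (Quotient.out q) + f x (y * Quotient.out q)) :=
      Finset.sum_congr rfl fun q _ => f_cocycle x y _
    rw [Finset.sum_add_distrib, Finset.sum_add_distrib, sum_f_mul, Finset.sum_const, Finset.card_univ,
      nsmul_eq_mul] at hsum
    simp only [hφ] at hsum ⊢
    linear_combination hsum
  -- the averaged correction
  obtain ⟨u, hu⟩ := hn.exists_left_inv
  refine ⟨fun g => sec g - u * φ g, fun x y => ?_⟩
  have h := card_mul_f x y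
  have hfxy : f x y = sec x + sec y + c x y - sec (x * y) := rfl
  have hf' : f x y = u * (φ x + φ y - φ (x * y)) := by rw [← h, ← mul_assoc, hu, one_mul]
  rw [hfxy] at hf'
  linear_combination -hf'

end Gaschuetz

/-- **Gaschütz averaging, packaged**: `H ≤ G` of finite index `n`, `n` invertible in the commutative ring `Z`, `c` a central
`2`-cocycle which is a coboundary on `H` ⟹ `c` is a coboundary on `G`. [folklore] -/
theorem exists_coboundary_of_coboundary_on_finiteIndex {G : Type*} [Group G] {Z : Type*} [CommRing Z]
    (H : Subgroup G) [H.FiniteIndex] (hn : IsUnit (H.index : Z)) (c : G → G → Z)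
    (hc : ∀ x y z : G, c x y + c (x * y) z = c y z + c x (y * z))
    (μ₀ : G → Z) (hμ₀ : ∀ h ∈ H, ∀ k ∈ H, μ₀ (h * k) = μ₀ h + μ₀ k + c h k) :
    ∃ μ : G → Z, ∀ x y : G, μ (x * y) = μ x + μ y + c x y := by
  haveI : Fintype (G ⧸ H) := H.fintypeQuotientOfFiniteIndex
  have hcard : (Fintype.card (G ⧸ H) : Z) = (H.index : Z) := by
    rw [H.index_eq_card, Nat.card_eq_fintype_card]
  exact Gaschuetz.exists_coboundary H (hcard ▸ hn) c hc μ₀ hμ₀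

end Summit.BirchSwinnertonDyer.BirchSwinnertonDyer.Theorems.ManinLocalTwoThree
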